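import Literature.Geometry.Lorentzian.VolumeChartFormula
import Literature.Geometry.Riemannian.CanonicalNeighbourhoods
import Mathlib.MeasureTheory.Function.Jacobian
import Mathlib.MeasureTheory.Constructions.Polish.Basic
import HarnessLib

/-!
# Two-sided volume comparison for an injective piece of an almost-isometric immersion

Stub `stub_injOnVolumeComparison` of line `ancient-sphere-rigidity` for the crux
`EntropyRung.SubcylindricalRecognition` (stmt-SmoothPoincare4-10869): if `g` is a Riemannian metric
on a `4`-manifold `M`, `Φ : ℝ⁴ → M` is smooth and injective on the open set `U ⊆ ℝ⁴`, and
`(1-η)|v|² ≤ g(dΦ v, dΦ v) ≤ (1+η)|v|²` on `U` for some `0 ≤ η < 1`, then for every measurable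
`S ⊆ U` the Riemannian measure `Vol_g = g.riemVolume` (the Euclidean-normalised `4`-dimensional
Hausdorff measure of the length metric, `Literature/Geometry/Lorentzian/Volume.lean`) of `Φ S`
satisfies `(1-η)² Leb(S) ≤ Vol_g(Φ S) ≤ (1+η)² Leb(S)`.

## Proof (fact-free)

* `abs_det_le_pow_of_norm_le`, `pow_le_abs_det_of_mul_norm_le`: for a linear endomorphism `T`
  of a finite-dimensional real normed space, `‖T v‖ ≤ K‖v‖ ⇒ |det T| ≤ Kⁿ` and
  `k‖v‖ ≤ ‖T v‖ ⇒ kⁿ ≤ |det T|` (Haar measure of balls: a linear map scales Haar measure by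
  `|det T|`, Mathlib's `addHaar_image_linearMap` / `addHaar_preimage_linearMap`).
* `ofReal_abs_det_fderiv_mul_sqrt_det_chartGramMatrix_mem`: at `y ∈ U` with `Φ y` in the domain
  of the chart `φ` at `p₀`, the Riemannian density `√(det g_{ij})` of the chart at `φ (Φ y)` is
  `|det A|` for a chart linearization `A` (`‖A w‖ = |D(φ⁻¹) w|_g`,
  `Literature/Geometry/Lorentzian/VolumeChartFormula.lean`), and `B = A ∘ D(φ ∘ Φ)(y)` has
  `‖B v‖ = |dΦ(y) v|_g` (chain rule, `D(φ⁻¹) ∘ Dφ = id`), so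
  `|det D(φ ∘ Φ)(y)| · √(det g_{ij}(φ (Φ y))) = |det B| ∈ [(1-η)², (1+η)²]`.
* `volume_image_le_and_le_of_mapsTo_chart`: for a measurable piece `s ⊆ U` with `Φ s` in one
  chart domain, `Vol_g(Φ s) = ∫_{φ (Φ s)} √(det g_{ij})` (the tree's chart formula
  `riemannianMeasure_eq_integral_sqrt_det_holds`) `= ∫_s |det D(φ ∘ Φ)| √(det g_{ij}) ∘ φ ∘ Φ`
  (Mathlib's change of variables `lintegral_image_eq_lintegral_abs_det_fderiv_mul` for the
  injective differentiable map `φ ∘ Φ` of `ℝ⁴`; `Φ s` is Borel by the Lusin–Souslin theorem).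
* `stub_injOnVolumeComparison`: a countable atlas of `M` (second countability), a
  disjointification of `S` into measurable pieces each mapped into one chart domain, countable
  additivity on both sides (`Φ` is injective on `U`).

## References

* H. Federer, *Geometric Measure Theory*, Springer 1969, §3.2.3 (area formula), §3.2.46
  (Hausdorff measure of a Riemannian manifold). [Federer1969]
-/

noncomputable section

open scoped Manifold ContDiff Topology ENNReal NNReal
open Set MeasureTheory Literature.Geometry.Lorentzian Literature.Geometry.Riemannian

namespace Summit.SmoothPoincare4.SmoothPoincare4.Theorems.SubcylindricalRecognition.AncientSphereRigidity

section Det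

variable {F : Type*} [NormedAddCommGroup F] [NormedSpace ℝ F] [FiniteDimensional ℝ F]

open Metric Module in
/-- **`|det T| ≤ Kⁿ` if `‖T v‖ ≤ K ‖v‖` for all `v`** (`n = dim F`): the image of the unit ball
under `T` lies in the ball of radius `K`, and a linear map scales Haar measure by `|det T|`.
[folklore] -/
theorem abs_det_le_pow_of_norm_le (T : F →ₗ[ℝ] F) {K : ℝ} (hK : 0 ≤ K)
    (h : ∀ v, ‖T v‖ ≤ K * ‖v‖) : |LinearMap.det T| ≤ K ^ finrank ℝ F := by
  borelize F
  set μ : Measure F := Measure.addHaar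
  have hsub : T '' closedBall (0 : F) 1 ⊆ closedBall 0 K := by
    rintro _ ⟨v, hv, rfl⟩
    rw [mem_closedBall_zero_iff] at hv ⊢
    calc ‖T v‖ ≤ K * ‖v‖ := h v
      _ ≤ K * 1 := by gcongr
      _ = K := mul_one K
  have h1 : ENNReal.ofReal |LinearMap.det T| * μ (closedBall 0 1) ≤
      ENNReal.ofReal (K ^ finrank ℝ F) * μ (closedBall 0 1) := by
    rw [← Measure.addHaar_image_linearMap μ T, ← Measure.addHaar_closedBall' μ 0 hK]
    exact measure_mono hsub
  have hpos : μ (closedBall (0 : F) 1) ≠ 0 := (measure_closedBall_pos μ 0 one_pos).ne'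
  have htop : μ (closedBall (0 : F) 1) ≠ ⊤ := measure_closedBall_lt_top.ne
  exact (ENNReal.ofReal_le_ofReal_iff (by positivity)).1
    ((ENNReal.mul_le_mul_iff_left hpos htop).1 h1)

open Metric Module in
/-- **`kⁿ ≤ |det T|` if `k ‖v‖ ≤ ‖T v‖` for all `v`**, `k > 0` (`n = dim F`): `T` is injective, the
preimage of the ball of radius `k` lies in the unit ball, and the preimage under a linear map of
non-zero determinant scales Haar measure by `|det T|⁻¹`. [folklore] -/
theorem pow_le_abs_det_of_mul_norm_le (T : F →ₗ[ℝ] F) {k : ℝ} (hk : 0 < k)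
    (h : ∀ v, k * ‖v‖ ≤ ‖T v‖) : k ^ finrank ℝ F ≤ |LinearMap.det T| := by
  borelize F
  set μ : Measure F := Measure.addHaar
  have hker : LinearMap.ker T = ⊥ := by
    rw [LinearMap.ker_eq_bot']
    intro v hv
    have h1 : k * ‖v‖ ≤ 0 := by simpa [hv] using h v
    have h2 : ‖v‖ ≤ 0 := by
      by_contra h3
      linarith [mul_pos hk (not_le.1 h3)]
    exact norm_le_zero_iff.1 h2
  have hdet : LinearMap.det T ≠ 0 := fun h0 ↦ (LinearMap.det_eq_zero_iff_ker_ne_bot.1 h0) hker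
  have hsub : T ⁻¹' closedBall (0 : F) k ⊆ closedBall 0 1 := by
    intro v hv
    rw [mem_preimage, mem_closedBall_zero_iff] at hv
    rw [mem_closedBall_zero_iff]
    have h1 : k * ‖v‖ ≤ k * 1 := by rw [mul_one]; exact (h v).trans hv
    exact le_of_mul_le_mul_left h1 hk
  have h1 : ENNReal.ofReal |(LinearMap.det T)⁻¹| *
      (ENNReal.ofReal (k ^ finrank ℝ F) * μ (closedBall 0 1)) ≤ 1 * μ (closedBall 0 1) := by
    rw [← Measure.addHaar_closedBall' μ 0 hk.le, ← Measure.addHaar_preimage_linearMap μ hdet,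
      one_mul]
    exact measure_mono hsub
  have hpos : μ (closedBall (0 : F) 1) ≠ 0 := (measure_closedBall_pos μ 0 one_pos).ne'
  have htop : μ (closedBall (0 : F) 1) ≠ ⊤ := measure_closedBall_lt_top.ne
  rw [← mul_assoc, ← ENNReal.ofReal_mul (abs_nonneg _), ← ENNReal.ofReal_one] at h1
  have h2 := (ENNReal.ofReal_le_ofReal_iff zero_le_one).1
    ((ENNReal.mul_le_mul_iff_left hpos htop).1 h1)
  rw [abs_inv] at h2
  have hdpos : 0 < |LinearMap.det T| := abs_pos.2 hdet
  calc k ^ finrank ℝ F = |LinearMap.det T| * (|LinearMap.det T|⁻¹ * k ^ finrank ℝ F) := by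
        field_simp
    _ ≤ |LinearMap.det T| * 1 := by gcongr
    _ = |LinearMap.det T| := mul_one _

end Det

/-! ### The density of `Φ⁎ Vol_g` with respect to Lebesgue measure, pointwise -/

section Pointwise

variable {M : Type*} [TopologicalSpace M] [ChartedSpace (EuclideanSpace ℝ (Fin 4)) M]
  [IsManifold (𝓡 4) ∞ M]

open scoped Bundle in
/-- **Pointwise density bounds.** Let `g` be Riemannian on the `4`-manifold `M`, `Φ : ℝ⁴ → M`
smooth on the open `U` with `(1-η)|v|² ≤ g(dΦ v, dΦ v) ≤ (1+η)|v|²` on `U` (`0 ≤ η < 1`), `y ∈ U`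
with `Φ y` in the domain of the chart `φ = extChartAt p₀`. Then the product of the Jacobian
`|det D(φ ∘ Φ)(y)|` with the Riemannian density `√(det g_{ij}(φ (Φ y)))` of the chart lies in
`[(1-η)², (1+η)²]`: for a chart linearization `A` at `Φ y` (`‖A w‖ = |D(φ⁻¹) w|_g`,
`√(det g_{ij}) = |det A|`) the linear map `B = A ∘ D(φ ∘ Φ)(y)` of `ℝ⁴` has
`‖B v‖ = |dΦ(y) v|_g ∈ [√(1-η)|v|, √(1+η)|v|]`, whence `|det B| ∈ [(1-η)², (1+η)²]`. [folklore] -/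
theorem ofReal_abs_det_fderiv_mul_sqrt_det_chartGramMatrix_mem
    (g : PseudoRiemannianMetric (𝓡 4) ∞ (EuclideanSpace ℝ (Fin 4))
      (TangentSpace (𝓡 4) : M → Type _))
    (hg : g.IsRiemannian) {Φ : EuclideanSpace ℝ (Fin 4) → M} {U : Set (EuclideanSpace ℝ (Fin 4))}
    {η : ℝ} (h0 : 0 ≤ η) (hη : η < 1) (hU : IsOpen U) (hΦ : ContMDiffOn (𝓡 4) (𝓡 4) ∞ Φ U)
    (hD : ∀ y ∈ U, ∀ v : EuclideanSpace ℝ (Fin 4),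
      (1 - η) * ‖v‖ ^ 2 ≤ g.val (Φ y) (mfderiv (𝓡 4) (𝓡 4) Φ y v) (mfderiv (𝓡 4) (𝓡 4) Φ y v) ∧
      g.val (Φ y) (mfderiv (𝓡 4) (𝓡 4) Φ y v) (mfderiv (𝓡 4) (𝓡 4) Φ y v) ≤ (1 + η) * ‖v‖ ^ 2)
    (p₀ : M) {y : EuclideanSpace ℝ (Fin 4)} (hyU : y ∈ U)
    (hq : Φ y ∈ (chartAt (EuclideanSpace ℝ (Fin 4)) p₀).source) :
    ENNReal.ofReal ((1 - η) ^ 2) ≤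
        ENNReal.ofReal |(fderiv ℝ (extChartAt (𝓡 4) p₀ ∘ Φ) y).det| *
          ENNReal.ofReal (Real.sqrt (chartGramMatrix (g.toContMDiffRiemannianMetric hg) p₀
            (extChartAt (𝓡 4) p₀ (Φ y))).det) ∧
      ENNReal.ofReal |(fderiv ℝ (extChartAt (𝓡 4) p₀ ∘ Φ) y).det| *
          ENNReal.ofReal (Real.sqrt (chartGramMatrix (g.toContMDiffRiemannianMetric hg) p₀
            (extChartAt (𝓡 4) p₀ (Φ y))).det) ≤ ENNReal.ofReal ((1 + η) ^ 2) := by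
  -- the inner product spaces `(T_x M, g_x)`
  letI : Bundle.RiemannianBundle (fun x : M ↦ TangentSpace (𝓡 4) x) :=
    ⟨(g.toContMDiffRiemannianMetric hg).toContinuousRiemannianMetric.toRiemannianMetric⟩
  have hq' : Φ y ∈ (extChartAt (𝓡 4) p₀).source := by rwa [extChartAt_source]
  have hz : extChartAt (𝓡 4) p₀ (Φ y) ∈ (extChartAt (𝓡 4) p₀).target :=
    (extChartAt (𝓡 4) p₀).map_source hq'
  have h1η : 0 < 1 - η := by linarith
  -- a chart linearization `A` at `Φ y`: `‖A w‖ = |D(φ⁻¹)(φ (Φ y)) w|_g`; the density is `|det A|`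
  obtain ⟨A, hA⟩ := exists_norm_eq_norm_symmL (I := 𝓡 4) p₀ (Φ y)
  have hG : Real.sqrt (chartGramMatrix (g.toContMDiffRiemannianMetric hg) p₀
      (extChartAt (𝓡 4) p₀ (Φ y))).det =
        |LinearMap.det (A : EuclideanSpace ℝ (Fin 4) →ₗ[ℝ] EuclideanSpace ℝ (Fin 4))| := by
    rw [← sqrt_det_gram_symmL_eq_abs_det (EuclideanSpace.basisFun (Fin 4) ℝ) p₀ (Φ y) hA]
    congr 3
    ext i j
    rw [Matrix.of_apply, chartGramMatrix_eq_inner_symmL _ p₀ hz, EuclideanSpace.basisFun_apply,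
      EuclideanSpace.basisFun_apply, (extChartAt (𝓡 4) p₀).left_inv hq']
  -- differentiability of `Φ` at `y` and of the chart at `Φ y`
  have hΦy : MDifferentiableAt (𝓡 4) (𝓡 4) Φ y :=
    (hΦ.contMDiffAt (hU.mem_nhds hyU)).mdifferentiableAt (by simp)
  have hφ : MDifferentiableAt (𝓡 4) 𝓘(ℝ, EuclideanSpace ℝ (Fin 4)) (extChartAt (𝓡 4) p₀) (Φ y) :=
    mdifferentiableAt_extChartAt hq
  -- `D(φ⁻¹)(φ (Φ y)) (D(φ ∘ Φ)(y) v) = dΦ(y) v`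
  have hkey : ∀ v : EuclideanSpace ℝ (Fin 4),
      (trivializationAt (EuclideanSpace ℝ (Fin 4)) (TangentSpace (𝓡 4)) p₀).symmL ℝ (Φ y)
        (fderiv ℝ (extChartAt (𝓡 4) p₀ ∘ Φ) y v) = mfderiv (𝓡 4) (𝓡 4) Φ y v := by
    intro v
    rw [TangentBundle.symmL_trivializationAt hq, ← mfderiv_eq_fderiv, mfderiv_comp y hφ hΦy]
    have h := mfderivWithin_extChartAt_symm_comp_mfderiv_extChartAt' (I := 𝓡 4) hq'
    exact congr($h (mfderiv (𝓡 4) (𝓡 4) Φ y v))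
  -- `B = A ∘ D(φ ∘ Φ)(y)` has `‖B v‖² = g(dΦ v, dΦ v)`
  set B : EuclideanSpace ℝ (Fin 4) →L[ℝ] EuclideanSpace ℝ (Fin 4) :=
    A ∘L fderiv ℝ (extChartAt (𝓡 4) p₀ ∘ Φ) y with hB_def
  have hB : ∀ v : EuclideanSpace ℝ (Fin 4), ‖B v‖ ^ 2 =
      g.val (Φ y) (mfderiv (𝓡 4) (𝓡 4) Φ y v) (mfderiv (𝓡 4) (𝓡 4) Φ y v) := by
    intro v
    rw [hB_def, ContinuousLinearMap.comp_apply, hA, ← hkey v, ← real_inner_self_eq_norm_sq]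
    rfl
  -- two-sided norm bounds for `B`
  have hup : ∀ v : EuclideanSpace ℝ (Fin 4), ‖B v‖ ≤ Real.sqrt (1 + η) * ‖v‖ := by
    intro v
    rw [← Real.sqrt_sq (norm_nonneg (B v)), ← Real.sqrt_sq (norm_nonneg v),
      ← Real.sqrt_mul (by linarith), hB v]
    exact Real.sqrt_le_sqrt (hD y hyU v).2
  have hlow : ∀ v : EuclideanSpace ℝ (Fin 4), Real.sqrt (1 - η) * ‖v‖ ≤ ‖B v‖ := by
    intro v
    rw [← Real.sqrt_sq (norm_nonneg (B v)), ← Real.sqrt_sq (norm_nonneg v),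
      ← Real.sqrt_mul h1η.le, hB v]
    exact Real.sqrt_le_sqrt (hD y hyU v).1
  -- hence two-sided bounds for `|det B| = |det D(φ ∘ Φ)(y)| · |det A|`
  have hn : Module.finrank ℝ (EuclideanSpace ℝ (Fin 4)) = 4 := finrank_euclideanSpace_fin
  have hdetB : |LinearMap.det (B : EuclideanSpace ℝ (Fin 4) →ₗ[ℝ] EuclideanSpace ℝ (Fin 4))| =
      |(fderiv ℝ (extChartAt (𝓡 4) p₀ ∘ Φ) y).det| *
        |LinearMap.det (A : EuclideanSpace ℝ (Fin 4) →ₗ[ℝ] EuclideanSpace ℝ (Fin 4))| := by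
    rw [hB_def, ContinuousLinearMap.toLinearMap_comp, LinearMap.det_comp, abs_mul, mul_comm]
  have hdet_le : |LinearMap.det (B : EuclideanSpace ℝ (Fin 4) →ₗ[ℝ] EuclideanSpace ℝ (Fin 4))| ≤
      (1 + η) ^ 2 := by
    have h := abs_det_le_pow_of_norm_le
      (B : EuclideanSpace ℝ (Fin 4) →ₗ[ℝ] EuclideanSpace ℝ (Fin 4)) (Real.sqrt_nonneg _) hup
    rw [hn] at h
    calc _ ≤ Real.sqrt (1 + η) ^ 4 := h
      _ = (Real.sqrt (1 + η) ^ 2) ^ 2 := by ring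
      _ = (1 + η) ^ 2 := by rw [Real.sq_sqrt (by linarith)]
  have hdet_ge : (1 - η) ^ 2 ≤
      |LinearMap.det (B : EuclideanSpace ℝ (Fin 4) →ₗ[ℝ] EuclideanSpace ℝ (Fin 4))| := by
    have h := pow_le_abs_det_of_mul_norm_le
      (B : EuclideanSpace ℝ (Fin 4) →ₗ[ℝ] EuclideanSpace ℝ (Fin 4)) (Real.sqrt_pos.2 h1η) hlow
    rw [hn] at h
    calc (1 - η) ^ 2 = (Real.sqrt (1 - η) ^ 2) ^ 2 := by rw [Real.sq_sqrt h1η.le]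
      _ = Real.sqrt (1 - η) ^ 4 := by ring
      _ ≤ _ := h
  rw [hG, ← ENNReal.ofReal_mul (abs_nonneg _), ← hdetB]
  exact ⟨ENNReal.ofReal_le_ofReal hdet_ge, ENNReal.ofReal_le_ofReal hdet_le⟩

end Pointwise

/-! ### The comparison on a piece mapped into one chart, and the registered statement -/

section Local

variable {M : Type*} [TopologicalSpace M] [T2Space M] [ChartedSpace (EuclideanSpace ℝ (Fin 4)) M]
  [IsManifold (𝓡 4) ∞ M] [T3Space M] [MeasurableSpace M] [BorelSpace M]

/-- **The comparison for a measurable piece mapped into one chart domain.** With `g, Φ, U, η` as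
in `stub_injOnVolumeComparison` and `s ⊆ U` measurable with `Φ s` inside the domain of the chart
at `p₀`: `(1-η)² Leb(s) ≤ Vol_g(Φ s) ≤ (1+η)² Leb(s)`. Proof: `Φ s` is Borel (Lusin–Souslin),
`Vol_g(Φ s) = ∫_{φ(Φ s)} √(det g_{ij})` (chart formula
`riemannianMeasure_eq_integral_sqrt_det_holds`),
`= ∫_s |det D(φ ∘ Φ)| √(det g_{ij}) ∘ (φ ∘ Φ)` (Euclidean change of variables for the injective
differentiable map `φ ∘ Φ`, Mathlib's `lintegral_image_eq_lintegral_abs_det_fderiv_mul`), and the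
integrand lies in `[(1-η)², (1+η)²]` pointwise. Federer, *Geometric Measure Theory* (1969), §3.2.3.
[cite: Federer1969, §3.2.3] -/
theorem volume_image_le_and_le_of_mapsTo_chart
    (g : PseudoRiemannianMetric (𝓡 4) ∞ (EuclideanSpace ℝ (Fin 4))
      (TangentSpace (𝓡 4) : M → Type _))
    (hg : g.IsRiemannian) {Φ : EuclideanSpace ℝ (Fin 4) → M} {U : Set (EuclideanSpace ℝ (Fin 4))}
    {η : ℝ} (h0 : 0 ≤ η) (hη : η < 1) (hU : IsOpen U) (hΦ : ContMDiffOn (𝓡 4) (𝓡 4) ∞ Φ U)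
    (hinj : Set.InjOn Φ U)
    (hD : ∀ y ∈ U, ∀ v : EuclideanSpace ℝ (Fin 4),
      (1 - η) * ‖v‖ ^ 2 ≤ g.val (Φ y) (mfderiv (𝓡 4) (𝓡 4) Φ y v) (mfderiv (𝓡 4) (𝓡 4) Φ y v) ∧
      g.val (Φ y) (mfderiv (𝓡 4) (𝓡 4) Φ y v) (mfderiv (𝓡 4) (𝓡 4) Φ y v) ≤ (1 + η) * ‖v‖ ^ 2)
    (p₀ : M) {s : Set (EuclideanSpace ℝ (Fin 4))} (hsU : s ⊆ U) (hs : MeasurableSet s)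
    (hsrc : MapsTo Φ s (chartAt (EuclideanSpace ℝ (Fin 4)) p₀).source) :
    ENNReal.ofReal ((1 - η) ^ 2) * volume s ≤ g.riemVolume (Φ '' s) ∧
      g.riemVolume (Φ '' s) ≤ ENNReal.ofReal ((1 + η) ^ 2) * volume s := by
  have hΦc : ContinuousOn Φ U := hΦ.continuousOn
  have hms : MeasurableSet (Φ '' s) :=
    hs.image_of_continuousOn_injOn (hΦc.mono hsU) (hinj.mono hsU)
  have hsrc' : Φ '' s ⊆ (extChartAt (𝓡 4) p₀).source := by
    rw [extChartAt_source]
    exact hsrc.image_subset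
  -- chart formula
  have h1 : g.riemVolume (Φ '' s) = ∫⁻ z in extChartAt (𝓡 4) p₀ '' (Φ '' s), ENNReal.ofReal
      (Real.sqrt (chartGramMatrix (g.toContMDiffRiemannianMetric hg) p₀ z).det) := by
    rw [PseudoRiemannianMetric.riemVolume_eq hg]
    exact riemannianMeasure_eq_integral_sqrt_det_holds _ p₀ hms hsrc'
  -- Euclidean change of variables for `φ ∘ Φ` on `s`
  have hdiff : ∀ y ∈ s, HasFDerivWithinAt (extChartAt (𝓡 4) p₀ ∘ Φ)
      (fderiv ℝ (extChartAt (𝓡 4) p₀ ∘ Φ) y) s y := by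
    intro y hy
    have hΦy : MDifferentiableAt (𝓡 4) (𝓡 4) Φ y :=
      (hΦ.contMDiffAt (hU.mem_nhds (hsU hy))).mdifferentiableAt (by simp)
    have hφ : MDifferentiableAt (𝓡 4) 𝓘(ℝ, EuclideanSpace ℝ (Fin 4)) (extChartAt (𝓡 4) p₀)
        (Φ y) := mdifferentiableAt_extChartAt (hsrc hy)
    have h : DifferentiableAt ℝ (extChartAt (𝓡 4) p₀ ∘ Φ) y :=
      mdifferentiableAt_iff_differentiableAt.1 (hφ.comp y hΦy)
    exact h.hasFDerivAt.hasFDerivWithinAt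
  have hinjψ : InjOn (extChartAt (𝓡 4) p₀ ∘ Φ) s := by
    intro y hy y' hy' hyy'
    exact hinj (hsU hy) (hsU hy') ((extChartAt (𝓡 4) p₀).injOn (hsrc' (mem_image_of_mem Φ hy))
      (hsrc' (mem_image_of_mem Φ hy')) hyy')
  have h2 := lintegral_image_eq_lintegral_abs_det_fderiv_mul volume hs hdiff hinjψ
    (fun z ↦ ENNReal.ofReal
      (Real.sqrt (chartGramMatrix (g.toContMDiffRiemannianMetric hg) p₀ z).det))
  rw [h1, ← image_comp, h2]
  have h3 := fun y (hy : y ∈ s) ↦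
    ofReal_abs_det_fderiv_mul_sqrt_det_chartGramMatrix_mem g hg h0 hη hU hΦ hD p₀ (hsU hy) (hsrc hy)
  constructor
  · calc ENNReal.ofReal ((1 - η) ^ 2) * volume s = ∫⁻ _ in s, ENNReal.ofReal ((1 - η) ^ 2) :=
          (setLIntegral_const _ _).symm
      _ ≤ _ := setLIntegral_mono' hs (fun y hy ↦ (h3 y hy).1)
  · calc _ ≤ ∫⁻ _ in s, ENNReal.ofReal ((1 + η) ^ 2) :=
          setLIntegral_mono' hs (fun y hy ↦ (h3 y hy).2)
      _ = _ := setLIntegral_const _ _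

end Local

/-- **Stub 4 of line `ancient-sphere-rigidity` — two-sided volume comparison for an injective
piece of an almost-isometric immersion of an open subset of `ℝ⁴`** (Federer 1969 §3.2.3/§3.2.46
area formula, here through the tree's chart formula `riemannianMeasure_eq_integral_sqrt_det_holds`
and Mathlib's Euclidean change of variables): if `Φ` is smooth and injective on the open `U ⊆ ℝ⁴`
with `(1-η)|v|² ≤ g(dΦ v, dΦ v) ≤ (1+η)|v|²` (`0 ≤ η < 1`), then
`(1-η)² Leb(S) ≤ Vol_g(Φ S) ≤ (1+η)² Leb(S)` for every measurable `S ⊆ U`. Proof: cover `M` by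
countably many chart domains (second countability), cut `S` into the disjoint measurable pieces
`T_k = S ∩ (Φ⁻¹` of the `k`-th domain, disjointified`)`, apply
`volume_image_le_and_le_of_mapsTo_chart` to each piece and add up (`Φ` is injective on `U`, the
images `Φ T_k` are Borel by Lusin–Souslin). [cite: Federer1969, §3.2.3] -/
theorem stub_injOnVolumeComparison :
    ∀ (M : Type) [TopologicalSpace M] [T2Space M] [SecondCountableTopology M]
      [ChartedSpace (EuclideanSpace ℝ (Fin 4)) M] [IsManifold (𝓡 4) ∞ M]
      [T3Space M] [MeasurableSpace M] [BorelSpace M]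
      (g : PseudoRiemannianMetric (𝓡 4) ∞ (EuclideanSpace ℝ (Fin 4)) (TangentSpace (𝓡 4) : M → Type _))
      (_hg : g.IsRiemannian) (Φ : EuclideanSpace ℝ (Fin 4) → M) (U : Set (EuclideanSpace ℝ (Fin 4)))
      (η : ℝ), 0 ≤ η → η < 1 → IsOpen U → ContMDiffOn (𝓡 4) (𝓡 4) ∞ Φ U → Set.InjOn Φ U →
      (∀ y ∈ U, ∀ v : EuclideanSpace ℝ (Fin 4),
        (1 - η) * ‖v‖ ^ 2 ≤ g.val (Φ y) (mfderiv (𝓡 4) (𝓡 4) Φ y v) (mfderiv (𝓡 4) (𝓡 4) Φ y v) ∧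
        g.val (Φ y) (mfderiv (𝓡 4) (𝓡 4) Φ y v) (mfderiv (𝓡 4) (𝓡 4) Φ y v) ≤ (1 + η) * ‖v‖ ^ 2) →
      ∀ S ⊆ U, MeasurableSet S →
        ENNReal.ofReal ((1 - η) ^ 2) * volume S ≤ g.riemVolume (Φ '' S) ∧
        g.riemVolume (Φ '' S) ≤ ENNReal.ofReal ((1 + η) ^ 2) * volume S := by
  intro M _ _ _ _ _ _ _ _ g hg Φ U η h0 hη hU hΦ hinj hD S hSU hS
  rcases S.eq_empty_or_nonempty with rfl | ⟨y₀, hy₀⟩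
  · simp
  have hΦc : ContinuousOn Φ U := hΦ.continuousOn
  -- a countable atlas of `M`
  obtain ⟨t, ht_count, ht_cover⟩ : ∃ t : Set M, t.Countable ∧
      ⋃ p ∈ t, (chartAt (EuclideanSpace ℝ (Fin 4)) p).source = univ :=
    TopologicalSpace.countable_cover_nhds (fun p ↦
      (chartAt (EuclideanSpace ℝ (Fin 4)) p).open_source.mem_nhds (mem_chart_source _ p))
  have hmem : ∀ q : M, ∃ p ∈ t, q ∈ (chartAt (EuclideanSpace ℝ (Fin 4)) p).source := by
    intro q
    have : q ∈ ⋃ p ∈ t, (chartAt (EuclideanSpace ℝ (Fin 4)) p).source := by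
      rw [ht_cover]; exact mem_univ q
    simpa only [mem_iUnion, exists_prop] using this
  have htne : t.Nonempty := by
    obtain ⟨p, hp, -⟩ := hmem (Φ y₀)
    exact ⟨p, hp⟩
  obtain ⟨e, he⟩ := ht_count.exists_eq_range htne
  -- the open cover `V k = U ∩ Φ⁻¹(k-th chart domain)` of `U` and the disjoint pieces `T k` of `S`
  set V : ℕ → Set (EuclideanSpace ℝ (Fin 4)) := fun k ↦
    U ∩ Φ ⁻¹' (chartAt (EuclideanSpace ℝ (Fin 4)) (e k)).source with hV
  have hVo : ∀ k, IsOpen (V k) := fun k ↦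
    hΦc.isOpen_inter_preimage hU (chartAt (EuclideanSpace ℝ (Fin 4)) (e k)).open_source
  have hSV : S ⊆ ⋃ k, V k := by
    intro y hy
    obtain ⟨p, hp, hyp⟩ := hmem (Φ y)
    rw [he] at hp
    obtain ⟨k, rfl⟩ := hp
    exact mem_iUnion.2 ⟨k, hSU hy, hyp⟩
  set T : ℕ → Set (EuclideanSpace ℝ (Fin 4)) := fun k ↦ S ∩ disjointed V k with hT
  have hTm : ∀ k, MeasurableSet (T k) := fun k ↦
    hS.inter (MeasurableSet.disjointed (fun j ↦ (hVo j).measurableSet) k)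
  have hTd : Pairwise (Function.onFun Disjoint T) := fun i j hij ↦
    (disjoint_disjointed V hij).mono inter_subset_right inter_subset_right
  have hTS : ∀ k, T k ⊆ S := fun k ↦ inter_subset_left
  have hTV : ∀ k, T k ⊆ V k := fun k ↦ inter_subset_right.trans (disjointed_subset V k)
  have hST : S = ⋃ k, T k := by
    simp only [hT, ← inter_iUnion, iUnion_disjointed]
    exact (inter_eq_left.2 hSV).symm
  -- decompose both measures along the pieces
  have hvol : volume S = ∑' k, volume (T k) := by
    conv_lhs => rw [hST]
    exact measure_iUnion hTd hTm
  have himm : ∀ k, MeasurableSet (Φ '' T k) := fun k ↦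
    (hTm k).image_of_continuousOn_injOn (hΦc.mono ((hTS k).trans hSU))
      (hinj.mono ((hTS k).trans hSU))
  have himd : Pairwise (Function.onFun Disjoint fun k ↦ Φ '' T k) := fun i j hij ↦
    (hTd hij).image hinj ((hTS i).trans hSU) ((hTS j).trans hSU)
  have hμ : g.riemVolume (Φ '' S) = ∑' k, g.riemVolume (Φ '' T k) := by
    conv_lhs => rw [hST, image_iUnion]
    exact measure_iUnion himd himm
  have hk : ∀ k, ENNReal.ofReal ((1 - η) ^ 2) * volume (T k) ≤ g.riemVolume (Φ '' T k) ∧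
      g.riemVolume (Φ '' T k) ≤ ENNReal.ofReal ((1 + η) ^ 2) * volume (T k) := fun k ↦
    volume_image_le_and_le_of_mapsTo_chart g hg h0 hη hU hΦ hinj hD (e k) ((hTS k).trans hSU)
      (hTm k) (fun y hy ↦ ((hTV k) hy).2)
  constructor
  · rw [hvol, hμ, ← ENNReal.tsum_mul_left]
    exact ENNReal.tsum_le_tsum (fun k ↦ (hk k).1)
  · rw [hvol, hμ, ← ENNReal.tsum_mul_left]
    exact ENNReal.tsum_le_tsum (fun k ↦ (hk k).2)

end Summit.SmoothPoincare4.SmoothPoincare4.Theorems.SubcylindricalRecognition.AncientSphereRigidity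

end
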